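import Summits.HodgeConjecture.CorCM.GaloisKleinFourFactor
import Summits.HodgeConjecture.CorCM.GaloisSemidihedralModularNormalForms
import Mathlib.GroupTheory.SpecificGroups.Quaternion
import HarnessLib

/-!
# `Gal(K/ℚ) ≅ Q_{4n} × C₂ × C₂` (`n ≥ 2`, complex conjugation `(aⁿ, 1)`): simple DEGENERATE CM abelian varieties of
# dimension `8n` — the generalized quaternion / dicyclic CM fields die under a real biquadratic factor

COR-CM (cell `pub-hodgecm2`), binder seat b04 (gen 23), count-neutral claim CYCLIC-BY-MULTIPLIERS, part VII-b (the
first instance of part VII-a `CorCM/GaloisKleinFourFactor`).  KERNEL ONLY: theorems; no definition, no named fact, no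
`sorry`.  `HC_CM` is neither used nor claimed.

`Q_{4n}` is Mathlib's `QuaternionGroup n` (`a i`, `xa i`, `i ∈ ℤ/2n`; `Q₈ = QuaternionGroup 2`, and `QuaternionGroup n`
is the dicyclic group `Dic_n` of order `4n`).  Its only involution is `aⁿ` (§1 `quaternion_involution`), and the DOUBLE
INTERVAL `Ψ₀ = {aⁱ : i < n} ⊔ {xaⁱ : i < n}` is a CM set for `aⁿ` with trivial left stabiliser (§1
`quaternion_doubleInterval_leftStabiliser`).  Part VII-a
    (`exists_simple_degenerate_of_model_kleinFour_uniqueInvolution`,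
swapping the pairs of `xa⁰` and `xa¹`) then gives:

**`exists_simple_degenerate_of_quaternion_kleinFour`** — a Galois CM field `K` with `Gal(K/ℚ) ≅ Q_{4n} × C₂ × C₂`,
`n ≥ 2`, complex conjugation `(aⁿ, 1)` (i.e. `K = K₁ L`, `K₁` a `Q_{4n}`-CM field, `L` real biquadratic, disjoint) has a
SIMPLE DEGENERATE abelian variety of dimension `8n` with CM by `K`, with an exceptional Hodge class on some power.

CONTRAST (the point of this file): `Q_{2^{k+2}} × C₂` with `c` in the quaternion factor is GOOD (gen 20
`GaloisDicyclic.isStablyNondegenerate_of_ringHom_quaternion_times_two`; `Q₈ × C₂`, gen 16) — one real quadratic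
factor is harmless for the generalized quaternion CM fields, a real BIQUADRATIC factor is fatal.  Seat census
(`scratch/census32`, j176464): `Q₈ × C₂²` (order 32) has `1152` primitive degenerate types of rank `13` (of `17`), none
of them with a non-trivial right stabiliser (no skew certificate exists: `Q₈ × C₂²` has no core-free subgroup).

## References

* [Shimura1998] G. Shimura, *Abelian Varieties with Complex Multiplication and Modular Functions*, §6.2 Thm. 3,
  §8.2 Prop. 26, §18.2 Lemma (i).
* [Gordon1999HodgeAVSurvey] B. B. Gordon, *A survey of the Hodge conjecture for abelian varieties*, Thm. 6.4, §9.3.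
-/

noncomputable section

open CategoryTheory CategoryTheory.Limits NumberField
open scoped BigOperators

namespace Summit.HodgeConjecture.CorCM.GaloisModels

open Literature.NumberTheory.ComplexMultiplication
open Literature.AlgebraicGeometry.Motives (AbelianVariety CMType)
open Literature.AlgebraicGeometry.HodgeTheory
open Literature.AlgebraicGeometry.ComplexMultiplication (IsCMTypeRealisation)
open Literature.AlgebraicGeometry.Pohlmann1968
open Literature.Barriers.HodgeConjecture (divisorClassesSpan)
open Summit.HodgeConjecture.CorCM.CyclicAsymmetricHalves
open QuaternionGroup

/-! ## §1 The double interval of `Q_{4n}` -/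

section Quaternion

variable {n : ℕ}

/-- **The only involution of `Q_{4n}` is `aⁿ`** (`n ≥ 1`): `(a i)² = a(2i) = 1` forces `i ∈ {0, n}`, and
`(xa i)² = aⁿ ≠ 1`. [folklore] -/
theorem quaternion_involution [NeZero n] (y : QuaternionGroup n) (hy : y * y = 1) : y = 1 ∨ y = a n := by
  haveI : NeZero (2 * n) := ⟨by have := NeZero.ne n; omega⟩
  rcases y with i | i
  · rw [a_mul_a, ← a_zero] at hy
    have h2 : i + i = 0 := a.inj hy
    have hval := congrArg ZMod.val (show ((i.val + i.val : ℕ) : ZMod (2 * n)) = 0 by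
      rw [Nat.cast_add, ZMod.natCast_zmod_val, h2])
    rw [ZMod.val_natCast, ZMod.val_zero] at hval
    have hlt := i.val_lt
    obtain ⟨q, hq⟩ := Nat.dvd_of_mod_eq_zero hval
    rcases q with _ | _ | q
    · left
      have : i.val = 0 := by omega
      rw [← a_zero]
      congr 1
      exact (ZMod.val_eq_zero i).1 this
    · right
      have : i.val = n := by omega
      congr 1
      apply ZMod.val_injective
      rw [this, val_natCast_of_lt' (show n < 2 * n by have := NeZero.ne n; omega)]
    · exfalso
      have h4 : 2 * n * 2 ≤ 2 * n * (q + 2) := Nat.mul_le_mul_left _ (by omega)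
      generalize 2 * n * (q + 2) = N at hq h4
      omega
  · exfalso
    rw [xa_mul_xa, ← a_zero] at hy
    have h2 := a.inj hy
    rw [add_sub_cancel_right] at h2
    have := congrArg ZMod.val h2
    rw [val_natCast_of_lt' (show n < 2 * n by have := NeZero.ne n; omega), ZMod.val_zero] at this
    exact NeZero.ne n this

/-- **The double interval exists** as a finite set with `a i ∈ Ψ₀ ↔ i.val < n`, `xa i ∈ Ψ₀ ↔ i.val < n`. [folklore] -/
theorem exists_quaternionDoubleInterval [NeZero n] :
    ∃ Ψ₀ : Finset (QuaternionGroup n), (∀ i, a i ∈ Ψ₀ ↔ i.val < n) ∧ (∀ i, xa i ∈ Ψ₀ ↔ i.val < n) := by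
  classical
  refine ⟨Finset.univ.filter fun g : QuaternionGroup n =>
      QuaternionGroup.rec (motive := fun _ => Prop) (fun i => i.val < n) (fun i => i.val < n) g,
    fun i => ?_, fun i => ?_⟩ <;> simp

variable {Ψ₀ : Finset (QuaternionGroup n)}

/-- **CM set for `aⁿ`.** [cite: Shimura1998, §18.2 Lemma (i)] -/
theorem quaternion_doubleInterval_cm [NeZero n] (hA : ∀ i, a i ∈ Ψ₀ ↔ i.val < n)
    (hX : ∀ i, xa i ∈ Ψ₀ ↔ i.val < n) (g : QuaternionGroup n) : g ∈ Ψ₀ ↔ a n * g ∉ Ψ₀ := by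
  haveI : NeZero (2 * n) := ⟨by have := NeZero.ne n; omega⟩
  have hn := NeZero.ne n
  rcases g with i | i
  · rw [a_mul_a, hA, hA, add_comm, val_add_natCast_eq i (show n < 2 * n by omega)]
    have := i.val_lt
    split_ifs <;> omega
  · rw [a_mul_xa, hX, hX, show i - (n : ZMod (2 * n)) = i + (n : ZMod (2 * n)) by
      rw [sub_eq_add_neg, GaloisSemidihedral.neg_natCast_h (h := n)], val_add_natCast_eq i (show n < 2 * n by omega)]
    have := i.val_lt
    split_ifs <;> omega

/-- **TRIVIAL LEFT STABILISER of the double interval in `Q_{4n}`**: `a k` shifts the `a`-interval by `k` (so `k = 0`),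
and `xa k` maps the `a`-interval onto the `xa`-window `[k, k+n)` and the `xa`-interval onto `[n−k, 2n−k)`, never both
onto `[0, n)`. [cite: Shimura1998, §8.2 Prop. 26] -/
theorem quaternion_doubleInterval_leftStabiliser [NeZero n] (hA : ∀ i, a i ∈ Ψ₀ ↔ i.val < n)
    (hX : ∀ i, xa i ∈ Ψ₀ ↔ i.val < n) (v : QuaternionGroup n) (hv : v ≠ 1) :
    ∃ w : QuaternionGroup n, ¬ (w ∈ Ψ₀ ↔ v * w ∈ Ψ₀) := by
  haveI : NeZero (2 * n) := ⟨by have := NeZero.ne n; omega⟩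
  have hn := NeZero.ne n
  rcases v with k | k
  · -- `v = a k`, `k ≠ 0`
    have hk : k.val ≠ 0 := fun h0 => hv (by rw [← a_zero]; congr 1; exact (ZMod.val_eq_zero k).1 h0)
    have hklt := k.val_lt
    by_cases hkn : k.val < n
    · refine ⟨a ((n : ZMod (2 * n)) - k), fun hiff => ?_⟩
      rw [a_mul_a, add_sub_cancel, hA, hA, val_natCast_sub_eq k (show n < 2 * n by omega),
        val_natCast_of_lt' (show n < 2 * n by omega)] at hiff
      split_ifs at hiff <;> omega
    · refine ⟨a 0, fun hiff => ?_⟩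
      rw [a_mul_a, add_zero, hA, hA, ZMod.val_zero] at hiff
      omega
  · -- `v = xa k`: probes `a 0` and `a (n - k)` / `xa 0`
    have hklt := k.val_lt
    by_cases hk0 : k.val < n
    · by_cases hkz : k.val = 0
      · -- `k = 0`: `xa 0 * xa 0 = a n ∉ Ψ₀` but `xa 0 ∈ Ψ₀`
        refine ⟨xa 0, fun hiff => ?_⟩
        have hk' : k = 0 := (ZMod.val_eq_zero k).1 hkz
        rw [hk', xa_mul_xa, sub_zero, add_zero, hX, hA, ZMod.val_zero,
          val_natCast_of_lt' (show n < 2 * n by omega)] at hiff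
        omega
      · -- `0 < k < n`: `a (n - k) ∈ Ψ₀` but `xa k * a (n-k) = xa n ∉ Ψ₀`
        refine ⟨a ((n : ZMod (2 * n)) - k), fun hiff => ?_⟩
        rw [xa_mul_a, add_sub_cancel, hA, hX, val_natCast_sub_eq k (show n < 2 * n by omega),
          val_natCast_of_lt' (show n < 2 * n by omega)] at hiff
        split_ifs at hiff <;> omega
    · -- `k ≥ n`: `a 0 ∈ Ψ₀` but `xa k * a 0 = xa k ∉ Ψ₀`
      refine ⟨a 0, fun hiff => ?_⟩
      rw [xa_mul_a, add_zero, hA, hX, ZMod.val_zero] at hiff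
      omega

variable {K : Type} [Field K] [NumberField K] [IsCMField K] [IsGalois ℚ K]

/-- **THEOREM (`Q_{4n} × C₂ × C₂`, `n ≥ 2`).**  `K` Galois CM with
`Gal(K/ℚ) ≅ Q_{4n} × C₂ × C₂` (`QuaternionGroup n`) and complex conjugation `(aⁿ, 1)` — `K = K₁ L` with `K₁` a
`Q_{4n}`-CM field and `L` a real biquadratic field, disjoint: `K` has a SIMPLE DEGENERATE abelian variety of dimension
`8n` with CM by `K`, with an exceptional Hodge class on some power (the double interval swapped at the pairs of `xa⁰`
and `xa¹`; four-point balanced set of part VII-a).  In contrast `Q_{2^{k+2}} × C₂` with `c` in the quaternion factor is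
good (gen 20). [cite: Shimura1998, §6.2 Thm. 3 and §8.2 Prop. 26] [cite: Gordon1999HodgeAVSurvey, Thm. 6.4 and §9.3] -/
theorem exists_simple_degenerate_of_quaternion_kleinFour (h2 : 2 ≤ n)
    (e : (K ≃ₐ[ℚ] K) ≃* QuaternionGroup n × (Multiplicative (ZMod 2) × Multiplicative (ZMod 2)))
    (hc : e ((IsCMField.complexConj K).restrictScalars ℚ) = (a n, 1)) :
    ∃ (Φ : CMType K) (φ₀ : K →+* ℂ) (A : AbelianVariety ℂ) (ι : 𝓞 K →+* End A)
      (θ : K →+* Module.End ℂ (complexBetti A.X 1)),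
      IsPrimitive (ℂ ≃+* ℂ) Φ.1 φ₀ ∧ ¬ IsNondegenerate Φ ∧ IsCMTypeRealisation Φ A ι θ ∧ A.IsSimple ∧
      A.dim = 8 * n ∧
      ∃ n p : ℕ, ∃ x : complexBetti (⨁ fun _ : Fin n => A).X (2 * p), IsRationalClass x ∧
        IsOfHodgeType (⨁ fun _ : Fin n => A).dim (⨁ fun _ : Fin n => A).X (2 * p) p p x ∧
        x ∉ divisorClassesSpan (⨁ fun _ : Fin n => A).X (⨁ fun _ : Fin n => A).dim p := by
  classical
  haveI : NeZero n := ⟨by omega⟩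
  haveI : NeZero (2 * n) := ⟨by omega⟩
  obtain ⟨Ψ₀, hA, hX⟩ := exists_quaternionDoubleInterval (n := n)
  have hpq : (xa (1 : ZMod (2 * n)) : QuaternionGroup n) ≠ xa 0 ∧
      (xa (1 : ZMod (2 * n)) : QuaternionGroup n) ≠ a n * xa 0 := by
    haveI : Fact (1 < 2 * n) := ⟨by omega⟩
    constructor
    · intro h
      have := congrArg ZMod.val (xa.inj h)
      rw [ZMod.val_one, ZMod.val_zero] at this
      omega
    · rw [a_mul_xa, zero_sub, GaloisSemidihedral.neg_natCast_h (h := n)]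
      intro h
      have := congrArg ZMod.val (xa.inj h)
      rw [ZMod.val_one, val_natCast_of_lt' (show n < 2 * n by omega)] at this
      omega
  have hmain := exists_simple_degenerate_of_model_kleinFour_uniqueInvolution e (a n) hc
    quaternion_involution (by rw [QuaternionGroup.card]; omega) Ψ₀ (quaternion_doubleInterval_cm hA hX)
    (quaternion_doubleInterval_leftStabiliser hA hX) (xa 0) (xa 1) hpq
  rwa [QuaternionGroup.card, show 2 * (4 * n) = 8 * n by ring] at hmain

end Quaternion

end Summit.HodgeConjecture.CorCM.GaloisModels

end
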